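import Summits.AtomisticToContinuum.FouriersLaw.Theses.OddSectorIrreversibility
import Summits.AtomisticToContinuum.FouriersLaw.Theses.LocalOhmBV
import Summits.AtomisticToContinuum.FouriersLaw.Theses.MatthiessenLadder

/-!
# `BoundedResponse` — one shared item, three route decls, three closing compositions
(support for stmt-AtomisticToContinuum-10924)

The support item `BoundedResponse` (length-uniform boundedness of the finite-size conductivities
`D_N` of `pinnedChain ω₂ lam β γ` under weak-NESS uniqueness; Bonetto–Lebowitz–Rey-Bellet 2000
§6.3, the open "dependence of `D` on `L`") is wanted by three routes, each of which prints it as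
its own decl — `OddSectorIrreversibility.BoundedResponse`, `LocalOhmBV.BoundedResponse`,
`MatthiessenLadder.BoundedResponse` — and each of which supplies it by a glue implication from its
own cruxes (`WitnessGlue`, `LocalOhmGlue`, `IncrementGlue`). This file records, once, that

* the three decls are the same proposition (`Iff.rfl`: the gate prints the item's signature
  verbatim into every route file), so whichever supplier chain lands first closes the item for all
  three routes; and
* the closing step from each chain is a one-line composition — the item has no content of its own
  beyond its suppliers (the antecedents below are ledger items, all but `WitnessGlue` OPEN as of
  2026-08-16; the theorems are conditional on them and close nothing). Route rev 17 of
  `OddSectorIrreversibility` re-typed `WitnessGlue` (`TapLeakBound` in place of the held E3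
  `ClosedConeSensitivity`); the composition along that route is
  `boundedResponse_of_witnessGlue_tapLeak`, the two earlier names surviving as deprecated aliases.

All sorry-free.
-/

namespace Summit.AtomisticToContinuum.FouriersLaw.Theorems

open Summit.AtomisticToContinuum.FouriersLaw.Theses

/-- The `LocalOhmBV` copy of the shared item is the same proposition as the
`OddSectorIrreversibility` copy (both are the ledger signature of stmt-AtomisticToContinuum-10924,
printed verbatim). [folklore] -/
theorem boundedResponse_iff_localOhmBV :
    OddSectorIrreversibility.BoundedResponse ↔ LocalOhmBV.BoundedResponse :=
  Iff.rfl

/-- The `MatthiessenLadder` copy of the shared item is the same proposition as the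
`OddSectorIrreversibility` copy. [folklore] -/
theorem boundedResponse_iff_matthiessenLadder :
    OddSectorIrreversibility.BoundedResponse ↔ MatthiessenLadder.BoundedResponse :=
  Iff.rfl

/-- Closing composition along route `OddSectorIrreversibility`, rev ≥ 17 form: since rev 17
`WitnessGlue` (stmt-15160, proved: `OddSectorWitness.TapLeak.witnessGlue_proof`) is the
transport-witness theorem
`TapLeakBound → ConeScaleCorrector → SubBallisticWindow → BoundedResponse` — the held E3
`ClosedConeSensitivity` was replaced in its crux slot by the tap-leak budget
P = `TapLeakBound` (stmt-15159); the fixed-`N` corrector calculus `CorrectorTheory` is a lemma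
beneath it, `GibbsSteadyState` is proved, and weak-NESS uniqueness is `BoundedResponse`'s own
antecedent — so the shared item follows from `WitnessGlue`, P and the two cone cruxes E1/E2 alone.
Conditional on three open items (15159, 14069, 14070); it is `WitnessGlue` unfolded. Supersedes the
rev-5 / rev-11 compositions `boundedResponse_of_witnessGlue` /
`boundedResponse_of_witnessGlue_cruxes`, whose hypothesis `hE3 : ClosedConeSensitivity` no longer
feeds `WitnessGlue` (build-debt note (a) of the route file, rev 17); both names are kept below as
deprecated aliases of this theorem.
[folklore] -/
theorem boundedResponse_of_witnessGlue_tapLeak (hW : OddSectorIrreversibility.WitnessGlue)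
    (hP : OddSectorIrreversibility.TapLeakBound)
    (hE1 : OddSectorIrreversibility.ConeScaleCorrector)
    (hE2 : OddSectorIrreversibility.SubBallisticWindow) :
    OddSectorIrreversibility.BoundedResponse :=
  hW hP hE1 hE2

/-- Deprecated name of `boundedResponse_of_witnessGlue_tapLeak`: the rev-5 seven-hypothesis
composition (`WitnessGlue`, `CorrectorTheory`, E3 `ClosedConeSensitivity`, E1, E2,
`GibbsSteadyState`, `NessUnique` ⊢ `BoundedResponse`) stopped type-checking at route rev 17, when
`WitnessGlue`'s first antecedent became `TapLeakBound` instead of `ClosedConeSensitivity`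
(build-debt note (a) of the route file). [folklore] -/
@[deprecated boundedResponse_of_witnessGlue_tapLeak (since := "2026-08-16")]
alias boundedResponse_of_witnessGlue := boundedResponse_of_witnessGlue_tapLeak

/-- Closing composition along route `LocalOhmBV`: local Ohm law + BV temperature profile + finite
response profile, glued by `LocalOhmGlue`, give the `OddSectorIrreversibility` decl of the item
directly (the two copies agree definitionally). Conditional on four open items (12072, 12011,
12009, 12012). [folklore] -/
theorem boundedResponse_of_localOhmGlue (hG : LocalOhmBV.LocalOhmGlue)
    (hF : LocalOhmBV.FiniteResponseProfile) (hL : LocalOhmBV.LocalOhm)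
    (hB : LocalOhmBV.BVProfile) :
    OddSectorIrreversibility.BoundedResponse :=
  hG hF hL hB

/-- Closing composition along route `MatthiessenLadder`: prefix-increment bounds along the prefix
steady states, glued by `IncrementGlue`, give the `OddSectorIrreversibility` decl of the item
directly. Conditional on three open items (12780, 12776, 12778). [folklore] -/
theorem boundedResponse_of_incrementGlue (hG : MatthiessenLadder.IncrementGlue)
    (hI : MatthiessenLadder.PrefixIncrementBounds) (hS : MatthiessenLadder.PrefixSteadyStates) :
    OddSectorIrreversibility.BoundedResponse :=
  hG hI hS

/-- Deprecated name of `boundedResponse_of_witnessGlue_tapLeak`: the rev-11 four-hypothesis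
composition (`WitnessGlue`, E3 `ClosedConeSensitivity`, E1, E2 ⊢ `BoundedResponse`) stopped
type-checking at route rev 17, when `WitnessGlue`'s first antecedent became `TapLeakBound` instead
of `ClosedConeSensitivity` (build-debt note (a) of the route file); the rev-17 form with
`hP : TapLeakBound` in place of `hE3` is `boundedResponse_of_witnessGlue_tapLeak`. [folklore] -/
@[deprecated boundedResponse_of_witnessGlue_tapLeak (since := "2026-08-16")]
alias boundedResponse_of_witnessGlue_cruxes := boundedResponse_of_witnessGlue_tapLeak

end Summit.AtomisticToContinuum.FouriersLaw.Theorems
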